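import Literature.NumberTheory.Transcendental.ProjectiveSpace
import Mathlib.Analysis.Normed.Module.Connected
import Mathlib.LinearAlgebra.Complex.FiniteDimensional
import HarnessLib

/-!
# Complex projective space `ℙⁿ(ℂ)` is connected (proof file)

Sibling proof file of `Literature/NumberTheory/Transcendental/ProjectiveSpace.lean`. That file
equips Mathlib's projectivization `ℙ 𝕜 W` with the quotient topology
(`Projectivization.instTopologicalSpace`: the quotient of the subspace `{v : W // v ≠ 0}` by
`v ↦ [v]`), proves that `Projectivization.mk` is a continuous (open) quotient map, and vendors as a
*named fact* `Literature.connectedSpace_projectivization n` the statement that complex projective space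
`ℙⁿ(ℂ) = ℙ ℂ (Fin (n + 1) → ℂ)` is connected. This file **discharges that fact**
(`Literature.NumberTheory.Transcendental.connectedSpace_projectivization_holds`), with no input beyond Mathlib and the sibling file.

The argument is the printed one. `ℙⁿ = (ℂⁿ⁺¹ ∖ {0}) / ℂ*` carries the quotient topology of the
projection `π : ℂⁿ⁺¹ ∖ {0} → ℙⁿ` (Griffiths–Harris, Ch. 0 §2, p. 15; Huybrechts, §2.1, p. 56: "By
definition `ℙⁿ = (ℂⁿ⁺¹ ∖ {0})/ℂ*`"; Mumford, §2A, p. 20: "`ℙⁿ` carries the quotient topology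
inherited from `ℂⁿ⁺¹ − (0)`"), so `ℙⁿ` is the image of `ℂⁿ⁺¹ ∖ {0}` under a continuous
surjection; and `ℂⁿ⁺¹ ∖ {0}` is connected because `ℂⁿ⁺¹` is a real normed space of dimension
`2 (n + 1) > 1`, in which the complement of a point is connected (Mathlib
`isConnected_compl_singleton_of_one_lt_rank`). Hence `ℙⁿ(ℂ)` is connected for every `n ≥ 0`
(`ℙ⁰` is a point).

## Main statements

* `Literature.NumberTheory.Transcendental.connectedSpace_ne_zero_complex` — `{v : Fin (n + 1) → ℂ // v ≠ 0}` is a connected space.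
* `Literature.NumberTheory.Transcendental.connectedSpace_projectivization_holds` — the named fact
  `Literature.connectedSpace_projectivization n` holds: `ConnectedSpace (ℙ ℂ (Fin (n + 1) → ℂ))`.

## References

* P. Griffiths, J. Harris, *Principles of Algebraic Geometry*, Wiley (1978), Ch. 0 §2, p. 15.
  [GriffithsHarrisPrinciples1978]
* D. Huybrechts, *Complex Geometry. An Introduction*, Universitext, Springer (2005), §2.1, p. 56.
  [HuybrechtsCG2005]
* D. Mumford, *Algebraic Geometry I: Complex Projective Varieties*, Springer (1976), §2A, p. 20.
  [Mumford1981]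

## Mathlib

`isConnected_compl_singleton_of_one_lt_rank`, `Module.one_lt_rank_of_one_lt_finrank`,
`Complex.finrank_real_complex`, `Function.Surjective.connectedSpace` are used as is; the topology on
`ℙ 𝕜 W` and `Projectivization.continuous_mk`, `Projectivization.isQuotientMap_mk` come from the
sibling file. Both statements are theorems, not instances, following the sibling file's convention
(consumers holding `(h : connectedSpace_projectivization n)` are fed
`connectedSpace_projectivization_holds n`; others use `haveI`).
-/

open scoped LinearAlgebra.Projectivization
open Set Function Topology

namespace Literature.NumberTheory.Transcendental

open Projectivization

section ConnectedProofs

/-- The punctured space `ℂⁿ⁺¹ ∖ {0}` (as the subtype `{v // v ≠ 0}`) is connected: `ℂⁿ⁺¹` has real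
dimension `2 (n + 1) > 1`, and the complement of a point in a real normed space of dimension `> 1`
is connected (Mathlib `isConnected_compl_singleton_of_one_lt_rank`; the subtype of `{0}ᶜ` is
definitionally `{v // v ≠ 0}`). [cite: GriffithsHarrisPrinciples1978, Ch. 0 §2 p. 15] [folklore] -/
theorem connectedSpace_ne_zero_complex (n : ℕ) :
    ConnectedSpace {v : Fin (n + 1) → ℂ // v ≠ 0} := by
  have h1 : 1 < Module.rank ℝ (Fin (n + 1) → ℂ) := by
    apply Module.one_lt_rank_of_one_lt_finrank
    rw [Module.finrank_pi_fintype, Finset.sum_const, Finset.card_univ, Fintype.card_fin,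
      Complex.finrank_real_complex, smul_eq_mul]
    omega
  exact isConnected_iff_connectedSpace.1
    (isConnected_compl_singleton_of_one_lt_rank h1 (0 : Fin (n + 1) → ℂ))

/-- **Discharge of `Literature.NumberTheory.Transcendental.connectedSpace_projectivization`.** Complex projective space `ℙⁿ(ℂ)`
(with the quotient topology `Projectivization.instTopologicalSpace` of the sibling file) is
connected: it is the image of the connected space `ℂⁿ⁺¹ ∖ {0}`
(`connectedSpace_ne_zero_complex`) under the continuous surjection `v ↦ [v]`
(`Projectivization.continuous_mk`, `Projectivization.isQuotientMap_mk`). This is the argument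
printed in the sources: `ℙⁿ = (ℂⁿ⁺¹ ∖ {0}) / ℂ*` with the quotient topology.
[cite: GriffithsHarrisPrinciples1978, Ch. 0 §2 p. 15] [cite: HuybrechtsCG2005, §2.1 p. 56]
[cite: Mumford1981, §2A p. 20 (quotient topology from `ℂⁿ⁺¹ − (0)`)] -/
theorem connectedSpace_projectivization_holds (n : ℕ) : connectedSpace_projectivization n := by
  unfold connectedSpace_projectivization
  haveI := connectedSpace_ne_zero_complex n
  exact (isQuotientMap_mk (𝕜 := ℂ) (W := Fin (n + 1) → ℂ)).surjective.connectedSpace continuous_mk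

end ConnectedProofs

end Literature.NumberTheory.Transcendental
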